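import Summits.AtomisticToContinuum.Crystallization.Theorems.FrustratedLawDichotomyStrainedPatchHostCellsA

/-!
# «HostCells» part B (§2 the pins and the record) — sequel of `…StrainedPatchHostCellsA`

decomp-a2c lens-5 g61 node «HostCells» [61H] (crux `AperiodicFrustratedLawGap`, stmt-AtomisticToContinuum-27623, 27623 T-side [CORE-FAR] ⟸ TubeP ∧ CoverP; critic row 1084 VERIFIED 34/34 STD).
Split for the 400-line cap by the landing lane (hand-2 g29); the module docstring of part A describes the whole node.  Same namespace; all FQNs unchanged.
0 sorry; standard axioms; no instances / notation / `#eval`.  `--supports stmt-AtomisticToContinuum-27623`.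
-/

namespace Summit.AtomisticToContinuum.Crystallization.Theorems.FrustratedLawDichotomyStrainedPatchHostCells


open scoped BigOperators Classical
open Summit.AtomisticToContinuum.Crystallization.Theorems.FrustratedLawDichotomyPeriodicBlockFlags (goodAtScale_mono)
open Summit.AtomisticToContinuum.Crystallization.Theorems.FrustratedLawDichotomyRangeCut (Sep)
open Summit.AtomisticToContinuum.Crystallization.Theorems.FrustratedLawDichotomyMotifLemmas
open Summit.AtomisticToContinuum.Crystallization.Theorems.FrustratedLawDichotomyAveragingCut
open Summit.AtomisticToContinuum.Crystallization.Theorems.FrustratedLawDichotomyAveragingRuleCap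
open Summit.AtomisticToContinuum.Crystallization.Theorems.FrustratedLawDichotomyAveragingRuleTightFree
open Summit.AtomisticToContinuum.Crystallization.Theorems.FrustratedLawDichotomyExemptDoor (SitePred)
open Summit.AtomisticToContinuum.Crystallization.Theorems.FrustratedLawDichotomyExemptAbsorption
open Summit.AtomisticToContinuum.Crystallization.Theorems.FrustratedLawDichotomyExemptAbsorptionRecord
open Summit.AtomisticToContinuum.Crystallization.Theorems.FrustratedLawDichotomyCollarCensus
open Summit.AtomisticToContinuum.Crystallization.Theorems.FrustratedLawDichotomyCollarCensusKappa
open Summit.AtomisticToContinuum.Crystallization.Theorems.FrustratedLawDichotomyStrainedPatchHomSplit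
open Summit.AtomisticToContinuum.Crystallization.Theorems.FrustratedLawDichotomyStrainedPatchCleanCollar
open Summit.AtomisticToContinuum.Crystallization.Theorems.FrustratedLawDichotomyStrainedPatchHomTube
open Summit.AtomisticToContinuum.Crystallization.Theorems.FrustratedLawDichotomyStrainedPatchHomIsometry
open Summit.AtomisticToContinuum.Crystallization.Theorems.FrustratedLawDichotomyStrainedPatchHomTubeIso
open Summit.AtomisticToContinuum.Crystallization.Theorems.FrustratedLawDichotomyStrainedPatchPhaseCut
open Summit.AtomisticToContinuum.Crystallization.Theorems.FrustratedLawDichotomyStrainedPatchCoreTube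
open Summit.AtomisticToContinuum.Crystallization.Theorems.FrustratedLawDichotomyStrainedPatchCoreTubeRecord
open Summit.AtomisticToContinuum.Crystallization.Theorems.FrustratedLawDichotomyStrainedPatchCoreTubeMilli
open Summit.AtomisticToContinuum.Crystallization.Theorems.FrustratedLawDichotomyStrainedPatchStrainBands
open Summit.AtomisticToContinuum.Crystallization.Theorems.FrustratedLawDichotomyStrainedPatchChartFamilies
open Summit.AtomisticToContinuum.Crystallization.Theorems.FrustratedLawDichotomyStrainedPatchChartFamiliesBent
open Summit.AtomisticToContinuum.Crystallization.Theorems.FrustratedLawDichotomyStrainedPatchChartFamiliesPinned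
open Summit.AtomisticToContinuum.Crystallization.Theorems.FrustratedLawDichotomyStrainedPatchWindowFamilies

/-! ## §2. The pins and the record -/

/-- ★ THE CHART FAMILY OF RECORD: window-honest bent `133/10`-balls, bending class `bends0 = polyBends (1/200) (1/2000)`, centre `1/8`-good. -/
def FamP : (M₀ : ℕ) → (Fin M₀ → E3) → Fin M₀ → Prop := bentFamilyW bends0 (1 / 8)

/-- **(BC)ᴾ `CoverP` [GEOMETRIC · UNDECIDED · INSTRUMENTABLE ← COVER-60]** — every far-class record cluster is, modulo a linear isometry, `1/80`-charted on its
`63/10`-ball by a window-honest `bends0`-bent instance. -/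
def CoverP : Prop := FamilyCover FamP (24 / 5) (1 / 100) (1 / 8) (1 / 80)

/-- **(TF)ᴾ `TubeP` [CERTIFICATE: finite net + remainder, below]** — every admissible clean mono-phase cluster `1/80`-charted by such an instance scores `≥ 0`. -/
def TubeP : Prop := TubeFloor FamP (1 / 80)

/-- ★★★ THE RECORD NODE of g61: (TF)ᴾ ∧ (BC)ᴾ ⟹ `CoreOffTubeFloor (63/10) (63/10) (24/5) (1/100) 0`. -/
theorem coreOff_record_of_tubeP_of_coverP (hT : TubeP) (hC : CoverP) : CoreOffTubeFloor (63 / 10) (63 / 10) (24 / 5) (1 / 100) 0 :=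
  coreOff_of_tubeFloor_of_cover_eighth hT hC

/-- **`RemainderP N κ lam` [ASYMPTOTIC REGIME — the strongly bent instances the net does not reach; UNDECIDED · INSTRUMENTABLE ← BEND-61 · IDEA-NEEDED]**. -/
def RemainderP {K : ℕ} (N : RefNet K) (κ lam : ℝ) : Prop :=
  TubeFloor (fun M₀ h c₀ => FamP M₀ h c₀ ∧ ¬InNet N κ lam (1 / 80) M₀ h c₀) (1 / 80)

/-- ★★ THE CELLS: for ANY finite reference net, `K` fat-tube certificates ∧ the remainder floor ⟹ (TF)ᴾ. -/
theorem tubeP_of_netCert_of_remainder {K : ℕ} {N : RefNet K} {κ lam : ℝ} (hcert : NetCert N (1 / 80) κ lam) (hrem : RemainderP N κ lam) : TubeP :=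
  tubeFloor_of_net_of_remainder hcert hrem

/-- ★★★ [CORE-FAR] from the cells: `NetCert N (1/80) κ lam → RemainderP N κ lam → CoverP → CoreOffTubeFloor (63/10) (63/10) (24/5) (1/100) 0`. -/
theorem coreOff_record_of_cells {K : ℕ} {N : RefNet K} {κ lam : ℝ} (hcert : NetCert N (1 / 80) κ lam) (hrem : RemainderP N κ lam) (hC : CoverP) :
    CoreOffTubeFloor (63 / 10) (63 / 10) (24 / 5) (1 / 100) 0 :=
  coreOff_record_of_tubeP_of_coverP (tubeP_of_netCert_of_remainder hcert hrem) hC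

/-- ★ Threaded to the 27623 piece through the tree's record assembly (pieces of record as hypotheses, residual floor `φ₁ = 0`). -/
theorem strainedPatchRec_of_homFloor_625_of_tubeP_of_coverP
    (hHF : HomFloor (1 / 625)) (hT : TailPenalty (24 / 5) (1 / 1000)) (hRl : CoreCoreRelief (63 / 10) (63 / 10) (24 / 5) (1 / 100) (3 / 5000))
    (hTP : TubeP) (hC : CoverP) (hF : AnnularPhaseFloor (63 / 10) (24 / 5) (63 / 10) (1 / 1000)) (hP : PolyTextureFloor (63 / 10) (24 / 5) (1 / 1000))
    (hA : AnnularDefectFloor (24 / 5) (63 / 10)) (hD : DefectiveCollarFloor (24 / 5)) : StrainedPatchRec :=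
  strainedPatchRec_of_homFloor_of_tailPenalty_of_coreRelief_of_coreOff_of_annularPhase_of_poly_of_annular_of_near (by norm_num) hHF hT hRl
    seam_arith_core (coreOff_record_of_tubeP_of_coverP hTP hC) hF hP le_rfl (by norm_num) (by norm_num) hA hD

/-! ### Sanity: the trades of the pinned pieces -/

/-- `id ∈ bends0`: every window-honest HOMOGENEOUS instance is in the family of record. [formal bookkeeping] -/
theorem homFamily_le_famP : FamilyLE (homFamily (1 / 8)) FamP :=
  (homFamily_le_bentFamily id_mem_bends0 (1 / 8)).trans (bentFamily_le_W bends0 (1 / 8))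

/-- (TF)ᴾ gives the tube floor over the plain (radius `133/10`) bent family and over the homogeneous family. [formal bookkeeping] -/
theorem tubeFloor_bent_of_tubeP (h : TubeP) : TubeFloor (bentFamily bends0 (1 / 8)) (1 / 80) := h.anti_family (bentFamily_le_W bends0 (1 / 8))

/-- `tubeFloor_hom_of_tubeP` (docstring added by the landing lane; see the module docstring). [formal bookkeeping] -/
theorem tubeFloor_hom_of_tubeP (h : TubeP) : TubeFloor (homFamily (1 / 8)) (1 / 80) := h.anti_family homFamily_le_famP

/-- A cover by the plain bent family (or by homogeneous instances) gives (BC)ᴾ. [formal bookkeeping] -/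
theorem coverP_of_cover_bent (h : FamilyCover (bentFamily bends0 (1 / 8)) (24 / 5) (1 / 100) (1 / 8) (1 / 80)) : CoverP :=
  h.mono_family (bentFamily_le_W bends0 (1 / 8))

/-- `coverP_of_cover_hom` (docstring added by the landing lane; see the module docstring). [formal bookkeeping] -/
theorem coverP_of_cover_hom (h : FamilyCover (homFamily (1 / 8)) (24 / 5) (1 / 100) (1 / 8) (1 / 80)) : CoverP :=
  h.mono_family homFamily_le_famP

end Summit.AtomisticToContinuum.Crystallization.Theorems.FrustratedLawDichotomyStrainedPatchHostCells
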